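import Summits.Schanuel.Schanuel.Theses.DiophantineDichotomy

/-!
# `EPiSimultaneousType`: the common-field clause is load-bearing, and `a ≥ 1/2` is necessary,
modulo the COORDINATEWISE linear approximability of `(π, e)` (in print: Bugeaud 2003 + `e ∈ S`)
(negative lemmas for crux `stmt-Schanuel-6118`, route DiophantineDichotomy)

Hypothesis `hB` (a precise `Prop`, stated inline): there is `c > 0` such that for every `n ≥ 1` and
every `H₀` there are `H ≥ H₀` and `α = (α₁, α₂) ∈ ℂ²`, each `αᵢ` a root of a non-zero integer
polynomial of degree `≤ n` and naive height `≤ H`, with `max(|α₁ − π|, |α₂ − e|) ≤ H^{−cn}`.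
IN PRINT: Bugeaud, *Approximation simultanée par des nombres algébriques*, J. Théor. Nombres
Bordeaux 15 (2003) 665–672, as quoted in Bugeaud, *Approximation by Algebraic Numbers* (CUP 2004),
§3.8 p. 94: "If `ξ₁` or `ξ₂` is an S-number, it is proved in [131] that the answer is positive with
`Ψ(n) = c₂₃ n`" (to the two-dimensional Wirsing problem: infinitely many `H` with
`|ξᵢ − αᵢ| ≤ H^{−Ψ(n)}`, `αᵢ` real algebraic of degree `≤ n` and height `≤ H`), together with
"`e` is an S-number of type 1" (Popken 1929 / Mahler 1932; ibid. p. 83). Not yet vendored in tree.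

* `epiSimultaneousType_false_without_fieldDegree_of_coordLinear` — modulo `hB`, the crux with the
  common-field clause `[ℚ(γ₁, γ₂):ℚ] ≤ d` DELETED (coordinatewise degrees `≤ d` only) is false for
  every `a < 1`: the clause (i) is what pushes the exponent from the curve regime `ω(d) ≍ d` down.
* `epiSimultaneousType_half_false_of_coordLinear` — modulo `hB`, no witness of the crux has
  `a < 1/2`: the pair `(α₁, α₂)` lives in a field of degree `≤ n²` (`finrank_adjoin_pair_le`), so
  `C (n²)ᵃ ≥ cn − 1` for all `n`. (Second printed route to `a ≥ 1/2`, independent of Philippon's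
  approximation property in `P²`; cf. `Negative/RaceHalfFalse.lean`.)

Everything is proved; no named facts; cdisprove seat, Disproof.lean §3.
-/

set_option linter.dupNamespace false

noncomputable section

namespace Summit.Schanuel.Schanuel.Theorems

open Polynomial
open scoped IntermediateField

namespace EPiSimultaneousType

/-- A root of a non-zero integer polynomial of degree `≤ n` generates a field of degree `≤ n`.
[folklore] -/
theorem finrank_adjoin_simple_le_of_clause {z : ℂ} {n H : ℕ}
    (h : ∃ P : Polynomial ℤ, P ≠ 0 ∧ P.natDegree ≤ n ∧ (∀ k, |P.coeff k| ≤ (H : ℤ)) ∧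
      Polynomial.aeval z P = 0) :
    IsIntegral ℚ z ∧ Module.finrank ℚ ↥ℚ⟮z⟯ ≤ n := by
  obtain ⟨P, hP0, hdeg, -, hroot⟩ := h
  set Q : ℚ[X] := P.map (algebraMap ℤ ℚ) with hQ
  have hQ0 : Q ≠ 0 := (Polynomial.map_ne_zero_iff (algebraMap ℤ ℚ).injective_int).mpr hP0
  have hQroot : Polynomial.aeval z Q = 0 := by rw [hQ, Polynomial.aeval_map_algebraMap]; exact hroot
  have hint : IsIntegral ℚ z := isAlgebraic_iff_isIntegral.mp ⟨Q, hQ0, hQroot⟩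
  refine ⟨hint, ?_⟩
  rw [IntermediateField.adjoin.finrank hint]
  calc (minpoly ℚ z).natDegree ≤ Q.natDegree :=
        Polynomial.natDegree_le_natDegree (minpoly.degree_le_of_ne_zero ℚ z hQ0 hQroot)
    _ = P.natDegree := Polynomial.natDegree_map_eq_of_injective (algebraMap ℤ ℚ).injective_int P
    _ ≤ n := hdeg

/-- Two coordinates of degrees `≤ n` generate a field of degree `≤ n²`. [folklore] -/
theorem finrank_adjoin_pair_le {α : Fin 2 → ℂ} {n H : ℕ}
    (h : ∀ i, ∃ P : Polynomial ℤ, P ≠ 0 ∧ P.natDegree ≤ n ∧ (∀ k, |P.coeff k| ≤ (H : ℤ)) ∧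
      Polynomial.aeval (α i) P = 0) :
    Module.finrank ℚ ↥(IntermediateField.adjoin ℚ (Set.range α)) ≤ n ^ 2 := by
  obtain ⟨hi0, h0⟩ := finrank_adjoin_simple_le_of_clause (h 0)
  obtain ⟨hi1, h1⟩ := finrank_adjoin_simple_le_of_clause (h 1)
  haveI : FiniteDimensional ℚ ↥ℚ⟮α 0⟯ := IntermediateField.adjoin.finiteDimensional hi0
  haveI : FiniteDimensional ℚ ↥ℚ⟮α 1⟯ := IntermediateField.adjoin.finiteDimensional hi1
  have hle : IntermediateField.adjoin ℚ (Set.range α) ≤ ℚ⟮α 0⟯ ⊔ ℚ⟮α 1⟯ := by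
    rw [IntermediateField.adjoin_le_iff]
    rintro _ ⟨i, rfl⟩
    fin_cases i
    · exact (le_sup_left : ℚ⟮α 0⟯ ≤ ℚ⟮α 0⟯ ⊔ ℚ⟮α 1⟯) (IntermediateField.mem_adjoin_simple_self ℚ _)
    · exact (le_sup_right : ℚ⟮α 1⟯ ≤ ℚ⟮α 0⟯ ⊔ ℚ⟮α 1⟯) (IntermediateField.mem_adjoin_simple_self ℚ _)
  calc Module.finrank ℚ ↥(IntermediateField.adjoin ℚ (Set.range α))
      ≤ Module.finrank ℚ ↥(ℚ⟮α 0⟯ ⊔ ℚ⟮α 1⟯) := IntermediateField.finrank_le_of_le_right hle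
    _ ≤ Module.finrank ℚ ↥ℚ⟮α 0⟯ * Module.finrank ℚ ↥ℚ⟮α 1⟯ := IntermediateField.finrank_sup_le _ _
    _ ≤ n * n := Nat.mul_le_mul h0 h1
    _ = n ^ 2 := (sq n).symm

/-- Choice of the degree in the race against a coordinatewise-linear family: for `0 ≤ e < 1` there
is `n ≥ 1` with `c·n ≥ C'·nᵉ + 1`. [folklore] -/
theorem exists_nat_linear_beats_rpow {c C' e : ℝ} (hc : 0 < c) (he0 : 0 ≤ e) (he1 : e < 1) :
    ∃ n : ℕ, 1 ≤ n ∧ C' * (n : ℝ) ^ e + 1 ≤ c * n := by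
  have hten : Filter.Tendsto (fun x : ℝ => x ^ (1 - e)) Filter.atTop Filter.atTop :=
    tendsto_rpow_atTop (by linarith)
  have hev := (hten.comp tendsto_natCast_atTop_atTop).eventually_ge_atTop ((|C'| + 1) / c)
  obtain ⟨n, hn1, hn⟩ := ((Filter.eventually_ge_atTop 1).and hev).exists
  refine ⟨n, hn1, ?_⟩
  have hn1' : (1 : ℝ) ≤ n := by exact_mod_cast hn1
  have hn0 : (0 : ℝ) < n := by linarith
  have hne : (1 : ℝ) ≤ (n : ℝ) ^ e := Real.one_le_rpow hn1' he0
  have hsplit : (n : ℝ) = (n : ℝ) ^ e * (n : ℝ) ^ (1 - e) := by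
    rw [← Real.rpow_add hn0]; simp
  have hkey : (|C'| + 1) ≤ c * (n : ℝ) ^ (1 - e) := by
    have := hn; simp only [Function.comp] at this
    rwa [div_le_iff₀' hc] at this
  calc C' * (n : ℝ) ^ e + 1 ≤ |C'| * (n : ℝ) ^ e + 1 * (n : ℝ) ^ e := by
        gcongr
        · exact le_abs_self C'
        · simpa using hne
    _ = (|C'| + 1) * (n : ℝ) ^ e := by ring
    _ ≤ (c * (n : ℝ) ^ (1 - e)) * (n : ℝ) ^ e := by gcongr
    _ = c * n := by rw [mul_assoc, mul_comm ((n : ℝ) ^ (1 - e)), ← hsplit]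

end EPiSimultaneousType

open EPiSimultaneousType

/-- **The common-field clause of `EPiSimultaneousType` is load-bearing**, modulo the coordinatewise
linear approximability `hB` of `(π, e)` (in print: Bugeaud 2003 + `e ∈ S`): the measure with
`[ℚ(γ):ℚ] ≤ d` deleted (only the per-coordinate integer-polynomial clause kept) fails for every
`a < 1` and every `b`, `C > 0`. [folklore] -/
theorem epiSimultaneousType_false_without_fieldDegree_of_coordLinear
    (hB : ∃ c : ℝ, 0 < c ∧ ∀ n : ℕ, 1 ≤ n → ∀ H₀ : ℕ, ∃ H : ℕ, H₀ ≤ H ∧ ∃ α : Fin 2 → ℂ,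
      (∀ i, ∃ P : Polynomial ℤ, P ≠ 0 ∧ P.natDegree ≤ n ∧ (∀ k, |P.coeff k| ≤ (H : ℤ)) ∧
        Polynomial.aeval (α i) P = 0) ∧
      ‖α - ![(Real.pi : ℂ), (Real.exp 1 : ℂ)]‖ ≤ (H : ℝ) ^ (-(c * n))) :
    ¬ ∃ a b C : ℝ, a < 1 ∧ 0 < C ∧ ∀ (d H : ℕ) (γ : Fin 2 → ℂ),
      (∀ i, ∃ P : Polynomial ℤ, P ≠ 0 ∧ P.natDegree ≤ d ∧ (∀ k, |P.coeff k| ≤ (H : ℤ)) ∧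
        Polynomial.aeval (γ i) P = 0) →
      Real.exp (-(C * ((d : ℝ) ^ a * Real.log H + (d : ℝ) ^ b))) ≤
        ‖γ - ![(Real.pi : ℂ), (Real.exp 1 : ℂ)]‖ := by
  rintro ⟨a, b, C, ha, hC, hM⟩
  obtain ⟨c, hc, hB⟩ := hB
  set e : ℝ := max a 0 with hedef
  have he0 : 0 ≤ e := le_max_right _ _
  have he1 : e < 1 := max_lt ha one_pos
  have hae : a ≤ e := le_max_left _ _
  obtain ⟨n, hn1, hn⟩ := exists_nat_linear_beats_rpow (C' := C) hc he0 he1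
  obtain ⟨H, hH0, α, hcl, hdist⟩ := hB n hn1 (⌈Real.exp (C * (n : ℝ) ^ b)⌉₊ + 2)
  have hn1' : (1 : ℝ) ≤ n := by exact_mod_cast hn1
  have hH2 : (2 : ℝ) ≤ H := by
    have : (2 : ℕ) ≤ H := le_trans (Nat.le_add_left 2 _) hH0
    exact_mod_cast this
  have hHpos : (0 : ℝ) < H := by linarith
  have hlogH : C * (n : ℝ) ^ b < Real.log H := by
    have h1 : Real.exp (C * (n : ℝ) ^ b) ≤ ⌈Real.exp (C * (n : ℝ) ^ b)⌉₊ := Nat.le_ceil _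
    have h2 : ((⌈Real.exp (C * (n : ℝ) ^ b)⌉₊ + 2 : ℕ) : ℝ) ≤ H := by exact_mod_cast hH0
    push_cast at h2
    rw [← Real.exp_lt_exp, Real.exp_log hHpos]
    linarith
  have hmeas := hM n H α hcl
  -- the bound beats H^{-cn}
  have key : (H : ℝ) ^ (-(c * n)) < Real.exp (-(C * ((n : ℝ) ^ a * Real.log H + (n : ℝ) ^ b))) := by
    rw [Real.rpow_def_of_pos hHpos, Real.exp_lt_exp]
    have hna : (n : ℝ) ^ a ≤ (n : ℝ) ^ e := Real.rpow_le_rpow_of_exponent_le hn1' hae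
    have hlog0 : 0 < Real.log H := Real.log_pos (by linarith)
    have h1 : C * ((n : ℝ) ^ a * Real.log H) ≤ C * (n : ℝ) ^ e * Real.log H := by
      rw [mul_assoc]; gcongr
    -- (c n - C n^e) log H ≥ log H > C n^b
    nlinarith [mul_le_mul_of_nonneg_right hn hlog0.le]
  linarith [hmeas, hdist, key]

/-- **`a ≥ 1/2` is necessary in `EPiSimultaneousType`, modulo the coordinatewise linear
approximability `hB` of `(π, e)`** (in print: Bugeaud 2003 + `e ∈ S`): the pair `(α₁, α₂)` of
`hB` is admissible at level `(n², H)`, so the crux with `a < 1/2` (everything else verbatim) is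
false. Second printed route to the window `1/2 ≤ a < 1`, independent of Philippon's approximation
property in `P²`. [folklore] -/
theorem epiSimultaneousType_half_false_of_coordLinear
    (hB : ∃ c : ℝ, 0 < c ∧ ∀ n : ℕ, 1 ≤ n → ∀ H₀ : ℕ, ∃ H : ℕ, H₀ ≤ H ∧ ∃ α : Fin 2 → ℂ,
      (∀ i, ∃ P : Polynomial ℤ, P ≠ 0 ∧ P.natDegree ≤ n ∧ (∀ k, |P.coeff k| ≤ (H : ℤ)) ∧
        Polynomial.aeval (α i) P = 0) ∧
      ‖α - ![(Real.pi : ℂ), (Real.exp 1 : ℂ)]‖ ≤ (H : ℝ) ^ (-(c * n))) :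
    ¬ ∃ a b C : ℝ, a < 1 / 2 ∧ 0 < C ∧ ∀ (d H : ℕ) (γ : Fin 2 → ℂ),
      Module.finrank ℚ ↥(IntermediateField.adjoin ℚ (Set.range γ)) ≤ d →
      (∀ i, ∃ P : Polynomial ℤ, P ≠ 0 ∧ P.natDegree ≤ d ∧ (∀ k, |P.coeff k| ≤ (H : ℤ)) ∧
        Polynomial.aeval (γ i) P = 0) →
      Real.exp (-(C * ((d : ℝ) ^ a * Real.log H + (d : ℝ) ^ b))) ≤
        ‖γ - ![(Real.pi : ℂ), (Real.exp 1 : ℂ)]‖ := by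
  rintro ⟨a, b, C, ha, hC, hM⟩
  obtain ⟨c, hc, hB⟩ := hB
  set e : ℝ := 2 * max a 0 with hedef
  have he0 : 0 ≤ e := by rw [hedef]; positivity
  have he1 : e < 1 := by
    rw [hedef]
    have : max a 0 < 1 / 2 := max_lt ha (by norm_num)
    linarith
  have hae : 2 * a ≤ e := by rw [hedef]; linarith [le_max_left a 0]
  obtain ⟨n, hn1, hn⟩ := exists_nat_linear_beats_rpow (C' := C) hc he0 he1
  obtain ⟨H, hH0, α, hcl, hdist⟩ := hB n hn1 (⌈Real.exp (C * ((n : ℝ) ^ 2) ^ b)⌉₊ + 2)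
  have hn1' : (1 : ℝ) ≤ n := by exact_mod_cast hn1
  have hn0 : (0 : ℝ) < n := by linarith
  have hH2 : (2 : ℝ) ≤ H := by
    have : (2 : ℕ) ≤ H := le_trans (Nat.le_add_left 2 _) hH0
    exact_mod_cast this
  have hHpos : (0 : ℝ) < H := by linarith
  have hlogH : C * ((n : ℝ) ^ 2) ^ b < Real.log H := by
    have h1 : Real.exp (C * ((n : ℝ) ^ 2) ^ b) ≤ ⌈Real.exp (C * ((n : ℝ) ^ 2) ^ b)⌉₊ := Nat.le_ceil _
    have h2 : ((⌈Real.exp (C * ((n : ℝ) ^ 2) ^ b)⌉₊ + 2 : ℕ) : ℝ) ≤ H := by exact_mod_cast hH0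
    push_cast at h2
    rw [← Real.exp_lt_exp, Real.exp_log hHpos]
    linarith
  -- admissible at level (n², H)
  have hfin : Module.finrank ℚ ↥(IntermediateField.adjoin ℚ (Set.range α)) ≤ n ^ 2 :=
    finrank_adjoin_pair_le hcl
  have hcl2 : ∀ i, ∃ P : Polynomial ℤ, P ≠ 0 ∧ P.natDegree ≤ n ^ 2 ∧
      (∀ k, |P.coeff k| ≤ (H : ℤ)) ∧ Polynomial.aeval (α i) P = 0 := by
    intro i
    obtain ⟨P, hP0, hdeg, hHt, hroot⟩ := hcl i
    exact ⟨P, hP0, hdeg.trans (by nlinarith), hHt, hroot⟩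
  have hmeas := hM (n ^ 2) H α hfin hcl2
  have hcast : ((n ^ 2 : ℕ) : ℝ) = (n : ℝ) ^ 2 := by push_cast; ring
  rw [hcast] at hmeas
  have key : (H : ℝ) ^ (-(c * n)) <
      Real.exp (-(C * (((n : ℝ) ^ 2) ^ a * Real.log H + ((n : ℝ) ^ 2) ^ b))) := by
    rw [Real.rpow_def_of_pos hHpos, Real.exp_lt_exp]
    have hna : ((n : ℝ) ^ 2) ^ a ≤ (n : ℝ) ^ e := by
      rw [show ((n : ℝ) ^ 2) = (n : ℝ) ^ (2 : ℝ) by norm_cast, ← Real.rpow_mul hn0.le]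
      exact Real.rpow_le_rpow_of_exponent_le hn1' hae
    have hlog0 : 0 < Real.log H := Real.log_pos (by linarith)
    have h1 : C * (((n : ℝ) ^ 2) ^ a * Real.log H) ≤ C * (n : ℝ) ^ e * Real.log H := by
      rw [mul_assoc]; gcongr
    nlinarith [mul_le_mul_of_nonneg_right hn hlog0.le]
  linarith [hmeas, hdist, key]

end Summit.Schanuel.Schanuel.Theorems

end
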